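/-
Copyright (c) 2026 the pub-hodgecm-mathlib formalisation cell (harness21).  Prover seat hodgecm-mathlib-K2Liu-p08 (g6), Track B «K2-LIT»,
#184♮ = hLiu418 = `stmt-HodgeConjecture-24832`; #42S BLOCK D, row D-2, (σ-A) mini-road (LEAD F0P6-plan (g15) RULING M-160f ∕ BATCH #238),
brick [A4-alg]: THE SUPPORT GEOMETRY OF THE STAGE FUNCTIONAL — Witt's norm class of a vector orthogonal to an isotropic vector in a
non-degenerate hermitian 3-space.  THEOREMS ONLY (no `def`, no `instance`, no `notation`, no named-fact hypothesis, no `sorry`, default heartbeats).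
-/
import Mathlib.LinearAlgebra.Matrix.Nondegenerate
import Mathlib.LinearAlgebra.Matrix.Determinant.Basic
import Literature.NumberTheory.Rogawski1990.RamifiedPlaceNormSymbolDichotomy        -- ★ `hilbertSymbol_eq_one_iff_exists_norm_toPlace` (norms from `L_w` ↔ `(·, θ)_v = 1`)
import Literature.NumberTheory.Automorphic.UnitaryGroupInertPlaceHyperbolicBasis   -- ★ `galAdicCompletionMap_galAdicCompletionMap_of_smul_eq` (`σ_w` is an involution)
import HarnessLib

/-!
# Crux `HLiu418`, #42S BLOCK D, row D-2, (σ-A) brick [A4-alg]: THE NORM CLASS ON THE INCIDENCE VARIETY `{⟨s,s⟩ = 0, ⟨s,t⟩ = 0}`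

Cell `hodgecm-mathlib`, crux item hLiu418 = `stmt-HodgeConjecture-24832` (helper lane `--supports … --as helper`, count-neutral; closes no socket);
squad K2 ∕ K2Liu (L1).  Prover K2Liu-p08 (g6) = typing pen of [A4] under the (σ-A) road desk K2Liu-p25 (g3); LEAD F0P6-plan (g15) BATCH #238.

THE POINT (census K2Liu-p08 (g6) 2026-09-05).  The stage-B value `N₂val(x)` of the local Siegel–Weil section at the #42S corner is, after the two stage
integrations `∫_y` ([A3] §1: Weil's null-cone density) and `∫_ζ` (Fourier inversion along `t ↦ ⟨t, s⟩`), the pairing of `ψ_v(x·⟨t,t⟩)·Φ_h(s,t)` against a Radon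
measure on `V′_v × V′_v` carried by the incidence variety `Z° = {s ≠ 0, ⟨s,s⟩ = 0, ⟨s,t⟩ = 0}` of the hermitian 3-space `V′_v`.  The whole `x`-dependence is
therefore governed by the values `⟨t,t⟩` ON `Z°`, and THIS file computes their class: for `s ≠ 0` isotropic and `t ⊥ s` in a non-degenerate hermitian
3-space of Gram matrix `A`,
  **`⟨t,t⟩ = −det A · N(y)` for some `y`** (`N(y) = y·ȳ`),
i.e. `⟨t,t⟩` is `0` or lies in the norm class of `−det A` — the class of the Witt line `s^⊥ ∕ E·s`, the same for every isotropic `s` (for `V′ = V₁ ⊕ H` it is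
the class of the line `V₁`).  At a DEAD bad place the Whittaker parameter is NOT in that class, so the corner character is non-trivial on every point of
`Z°` and the ball values of row D-2 die ([A4-close]).  This is Kudla–Rallis' «`W_T(F_Φ) = ∫_{⟨t,t⟩=σ} FD₀^{t^⊥}(Φ_h(·,t))`, `t^⊥` anisotropic at a dead place»
read in the cell's stage order.
PROOF (no case split, no invertibility of the frame): pick `u` with `⟨s,u⟩ = 1` (`A` non-singular, `s ≠ 0`), put `t′ := t − ⟨u,t⟩·s` (`⊥ s`, `⊥ u`,
`⟨t′,t′⟩ = ⟨t,t⟩`), `P := [s | u | t′]`; then `Pᴴ A P = !![0,1,0; 1,⟨u,u⟩,0; 0,0,⟨t,t⟩]` has determinant `−⟨t,t⟩`, while `det(Pᴴ A P) = N(det P)·det A`.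
* §1 the pairing `B(x,y) = (c ∘ x) ⬝ᵥ A *ᵥ y` for an involutive ring endomorphism `c` of a field `K` and `A` hermitian (`c (A i j) = A j i`): hermitian
  symmetry, sesquilinearity, the Gram matrix of a frame.
* §2 **`self_pairing_eq_neg_det_mul_norm`** (the theorem above) and its contrapositive reading **`self_pairing_ne_of_forall_ne_neg_det_mul_norm`**
  («a scalar outside the class `−det A · N(K)` is never a value `⟨t,t⟩` on `Z°`»).
Pure matrix algebra over any field with an involution; the local (Hilbert-symbol) reading at a finite place of a CM field is the consumer's one-liner over
★ `Rogawski1990.hilbertSymbol_eq_one_iff_exists_norm_toPlace`.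
[Omeara1963, §42 (42:17, hyperbolic planes) and §63B] [KudlaRallis1994, §2 (2.10)–(2.12)] [MoeglinVignerasWaldspurger1987, Chap. 1 I.10–I.11].
HONEST LABEL.  Count-neutral helper; closes no socket; `HC_CM` is proved only modulo the 7 printed citations (2 remaining named inputs:
hLiu418 = `stmt-HodgeConjecture-24832`, h413 = `stmt-HodgeConjecture-24833`) until rung 0 closes.  NOT here: the Radon presentation of the stage
functional ([A4-an]) and the ball-road closer ([A4-close]).

## References
* [Omeara1963] O. T. O'Meara, *Introduction to Quadratic Forms* (1963), §42 (42:17), §63B.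
* [KudlaRallis1994] S. Kudla, S. Rallis, *A regularized Siegel–Weil formula: the first term identity*, Ann. of Math. 140 (1994), §2 (2.10)–(2.12).
* [MoeglinVignerasWaldspurger1987] C. Mœglin, M.-F. Vignéras, J.-L. Waldspurger, LNM 1291 (1987), Chap. 1 I.10–I.11 (Witt decomposition for ε-hermitian spaces).
-/

set_option autoImplicit false
set_option linter.dupNamespace false -- the mandated namespace repeats `HodgeConjecture.HodgeConjecture`

open Matrix

namespace Summit.HodgeConjecture.HodgeConjecture.Cruxes.HLiu418.K2LiuIsotropicOrthogonalNormClass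

/-! ## §1 The hermitian pairing `B(x,y) = (c ∘ x) ⬝ᵥ A *ᵥ y` of a hermitian Gram matrix -/

section Pairing

variable {K : Type*} [Field K] (c : K →+* K) {n : Type*} [Fintype n]

/-- **hermitian symmetry**: for `c` involutive and `A` hermitian (`c (A i j) = A j i`), `c ((c ∘ x) ⬝ᵥ A *ᵥ y) = (c ∘ y) ⬝ᵥ A *ᵥ x`.
[cite: Omeara1963, §63B] -/
theorem map_conj_dotProduct_mulVec (hc : ∀ a, c (c a) = a) {A : Matrix n n K} (hA : ∀ i j, c (A i j) = A j i) (x y : n → K) :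
    c ((c ∘ x) ⬝ᵥ A *ᵥ y) = (c ∘ y) ⬝ᵥ A *ᵥ x := by
  simp only [dotProduct, mulVec, Function.comp_apply, map_sum, map_mul, hc, hA, Finset.mul_sum]
  rw [Finset.sum_comm]
  refine Finset.sum_congr rfl fun j _ => Finset.sum_congr rfl fun i _ => ?_
  ring

/-- additivity of the pairing in the second (linear) slot. [folklore] -/
theorem conj_dotProduct_mulVec_add (A : Matrix n n K) (x y z : n → K) :
    (c ∘ x) ⬝ᵥ A *ᵥ (y + z) = (c ∘ x) ⬝ᵥ A *ᵥ y + (c ∘ x) ⬝ᵥ A *ᵥ z := by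
  rw [mulVec_add, dotProduct_add]

/-- the pairing is subtractive in the second (linear) slot. [folklore] -/
theorem conj_dotProduct_mulVec_sub (A : Matrix n n K) (x y z : n → K) :
    (c ∘ x) ⬝ᵥ A *ᵥ (y - z) = (c ∘ x) ⬝ᵥ A *ᵥ y - (c ∘ x) ⬝ᵥ A *ᵥ z := by
  rw [mulVec_sub, dotProduct_sub]

/-- homogeneity of the pairing in the second (linear) slot. [folklore] -/
theorem conj_dotProduct_mulVec_smul (A : Matrix n n K) (x y : n → K) (a : K) :
    (c ∘ x) ⬝ᵥ A *ᵥ (a • y) = a * (c ∘ x) ⬝ᵥ A *ᵥ y := by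
  rw [mulVec_smul, dotProduct_smul, smul_eq_mul]

/-- the pairing is subtractive in the first (semilinear) slot. [folklore] -/
theorem conj_sub_dotProduct_mulVec (A : Matrix n n K) (x y z : n → K) :
    (c ∘ (x - y)) ⬝ᵥ A *ᵥ z = (c ∘ x) ⬝ᵥ A *ᵥ z - (c ∘ y) ⬝ᵥ A *ᵥ z := by
  have h : (c ∘ (x - y) : n → K) = (c ∘ x) - (c ∘ y) := funext fun i => by simp [map_sub]
  rw [h, sub_dotProduct]

/-- `c`-semilinearity of the pairing in the first slot: `B(a • x, y) = c a · B(x, y)`. [folklore] -/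
theorem conj_smul_dotProduct_mulVec (A : Matrix n n K) (x y : n → K) (a : K) :
    (c ∘ (a • x)) ⬝ᵥ A *ᵥ y = c a * (c ∘ x) ⬝ᵥ A *ᵥ y := by
  have h : (c ∘ (a • x) : n → K) = c a • (c ∘ x) := funext fun i => by simp [map_mul]
  rw [h, smul_dotProduct, smul_eq_mul]

/-- **the Gram matrix of a frame**: for `P` the matrix with COLUMNS `f 0, f 1, …` (`P k j = f j k`), `(Pᵀ.map c * A * P) i j = B(f i, f j)`.
[cite: Omeara1963, §41 (change of basis of a Gram matrix)] -/
theorem conjTranspose_mul_mul_apply {m : Type*} [Fintype m] (A : Matrix n n K) (f : m → n → K) (i j : m) :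
    ((Matrix.of fun k l => f l k)ᵀ.map c * A * Matrix.of fun k l => f l k) i j = (c ∘ f i) ⬝ᵥ A *ᵥ f j := by
  simp only [Matrix.mul_apply, Matrix.map_apply, Matrix.transpose_apply, Matrix.of_apply, dotProduct, mulVec,
    Function.comp_apply, Finset.sum_mul, Finset.mul_sum]
  rw [Finset.sum_comm]
  refine Finset.sum_congr rfl fun k _ => Finset.sum_congr rfl fun l _ => ?_
  ring

/-- the determinant of a `c`-conjugate transpose: `det (Pᵀ.map c) = c (det P)`. [folklore] -/
theorem det_transpose_map (P : Matrix n n K) [DecidableEq n] : (Pᵀ.map c).det = c P.det := by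
  rw [← RingHom.mapMatrix_apply, ← RingHom.map_det, det_transpose]

end Pairing

/-! ## §2 Witt: on `{⟨s,s⟩ = 0, s ≠ 0, ⟨s,t⟩ = 0}` the value `⟨t,t⟩` lies in the class `−det A · N(K)` -/

section Witt

variable {K : Type*} [Field K] (c : K →+* K)

/-- **THE NORM CLASS OF A VECTOR ORTHOGONAL TO AN ISOTROPIC VECTOR (hermitian 3-space).**  `K` a field with an involutive ring endomorphism `c`
(`N(y) := y · c y`), `A ∈ M₃(K)` hermitian (`c (A i j) = A j i`) and non-singular, `B(x,y) := (c ∘ x) ⬝ᵥ A *ᵥ y`.  If `s ≠ 0` is ISOTROPIC (`B(s,s) = 0`)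
and `t ⊥ s` (`B(s,t) = 0`), then **`B(t,t) = −det A · (y · c y)` for some `y ∈ K`**: `s^⊥ = K·s ⊕ L_s` with `L_s` a line of discriminant `−det A`
(the hyperbolic plane through `s` has discriminant `−1`), and `B` is constant along `K·s`-cosets of `s^⊥`.  Proof by one change of frame `P = [s | u | t′]`
(`B(s,u) = 1`, `t′ = t − B(u,t)·s`): `Pᴴ A P = !![0,1,0; 1,B(u,u),0; 0,0,B(t,t)]`, determinants both ways, `y := det P` (no invertibility needed).
[cite: Omeara1963, §42 (42:17)] [cite: MoeglinVignerasWaldspurger1987, Chap. 1 I.10–I.11] [cite: KudlaRallis1994, §2 (2.10)–(2.12)] -/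
theorem self_pairing_eq_neg_det_mul_norm (hc : ∀ a, c (c a) = a) {A : Matrix (Fin 3) (Fin 3) K}
    (hA : ∀ i j, c (A i j) = A j i) (hdet : A.det ≠ 0) {s : Fin 3 → K} (hs : s ≠ 0)
    (hss : (c ∘ s) ⬝ᵥ A *ᵥ s = 0) (t : Fin 3 → K) (hst : (c ∘ s) ⬝ᵥ A *ᵥ t = 0) :
    ∃ y : K, (c ∘ t) ⬝ᵥ A *ᵥ t = -A.det * (y * c y) := by
  classical
  have hsymm : ∀ x y : Fin 3 → K, c ((c ∘ x) ⬝ᵥ A *ᵥ y) = (c ∘ y) ⬝ᵥ A *ᵥ x := map_conj_dotProduct_mulVec c hc hA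
  -- step 1: a vector `u` with `B(s,u) = 1`
  have hw : Aᵀ *ᵥ (c ∘ s) ≠ 0 := by
    intro h
    have h1 : (c ∘ s : Fin 3 → K) = 0 := eq_zero_of_mulVec_eq_zero (by rwa [det_transpose]) h
    refine hs (funext fun i => ?_)
    have h2 := congr_fun h1 i
    rw [Function.comp_apply, Pi.zero_apply, map_eq_zero_iff c c.injective] at h2
    exact h2
  obtain ⟨i, hi⟩ := Function.ne_iff.1 hw
  set u : Fin 3 → K := Pi.single i ((Aᵀ *ᵥ (c ∘ s)) i)⁻¹ with hu
  have hsu : (c ∘ s) ⬝ᵥ A *ᵥ u = 1 := by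
    rw [dotProduct_mulVec, ← mulVec_transpose, hu, dotProduct_single, mul_inv_cancel₀ hi]
  have hus : (c ∘ u) ⬝ᵥ A *ᵥ s = 1 := by rw [← hsymm, hsu, map_one]
  have hts : (c ∘ t) ⬝ᵥ A *ᵥ s = 0 := by rw [← hsymm, hst, map_zero]
  -- step 2: `t′ := t − B(u,t)·s` is orthogonal to `s` and `u`, with the same self-pairing as `t`
  set α : K := (c ∘ u) ⬝ᵥ A *ᵥ t with hα
  set t' : Fin 3 → K := t - α • s with ht'
  have hst' : (c ∘ s) ⬝ᵥ A *ᵥ t' = 0 := by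
    rw [ht', conj_dotProduct_mulVec_sub, conj_dotProduct_mulVec_smul, hst, hss, mul_zero, sub_zero]
  have hut' : (c ∘ u) ⬝ᵥ A *ᵥ t' = 0 := by
    rw [ht', conj_dotProduct_mulVec_sub, conj_dotProduct_mulVec_smul, hus, mul_one, hα, sub_self]
  have ht's : (c ∘ t') ⬝ᵥ A *ᵥ s = 0 := by rw [← hsymm, hst', map_zero]
  have ht'u : (c ∘ t') ⬝ᵥ A *ᵥ u = 0 := by rw [← hsymm, hut', map_zero]
  have ht't' : (c ∘ t') ⬝ᵥ A *ᵥ t' = (c ∘ t) ⬝ᵥ A *ᵥ t := by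
    rw [ht', conj_dotProduct_mulVec_sub, conj_sub_dotProduct_mulVec, conj_sub_dotProduct_mulVec, conj_dotProduct_mulVec_smul,
      conj_dotProduct_mulVec_smul, conj_smul_dotProduct_mulVec, conj_smul_dotProduct_mulVec, hss, hst, hts]
    ring
  -- step 3: the frame `P = [s | u | t′]` and its Gram matrix
  set f : Fin 3 → Fin 3 → K := ![s, u, t'] with hf
  set P : Matrix (Fin 3) (Fin 3) K := Matrix.of fun k l => f l k with hP
  have hGram : Pᵀ.map c * A * P = !![0, 1, 0; 1, (c ∘ u) ⬝ᵥ A *ᵥ u, 0; 0, 0, (c ∘ t) ⬝ᵥ A *ᵥ t] := by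
    ext i j
    rw [hP, conjTranspose_mul_mul_apply c A f i j, hf]
    fin_cases i <;> fin_cases j <;>
      simp [hss, hsu, hus, hst', ht's, hut', ht'u, ht't']
  -- step 4: determinants both ways
  have hdet₁ : (Pᵀ.map c * A * P).det = -((c ∘ t) ⬝ᵥ A *ᵥ t) := by
    rw [hGram, Matrix.det_fin_three]
    simp
  have hdet₂ : (Pᵀ.map c * A * P).det = c P.det * A.det * P.det := by
    rw [det_mul, det_mul, det_transpose_map]
  refine ⟨P.det, ?_⟩
  have key := hdet₁.symm.trans hdet₂
  rw [neg_eq_iff_eq_neg.1 key]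
  ring

/-- **contrapositive reading (the support letter of the ball road)**: a scalar `β` which is NOT of the form `−det A · N(y)` is never a value `B(t,t)`
with `t` orthogonal to a non-zero isotropic `s`. [cite: KudlaRallis1994, §2 (2.10)–(2.12)] [cite: Omeara1963, §63B] -/
theorem self_pairing_ne_of_forall_ne_neg_det_mul_norm (hc : ∀ a, c (c a) = a) {A : Matrix (Fin 3) (Fin 3) K}
    (hA : ∀ i j, c (A i j) = A j i) (hdet : A.det ≠ 0) {s : Fin 3 → K} (hs : s ≠ 0)
    (hss : (c ∘ s) ⬝ᵥ A *ᵥ s = 0) (t : Fin 3 → K) (hst : (c ∘ s) ⬝ᵥ A *ᵥ t = 0)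
    {β : K} (hβ : ∀ y : K, β ≠ -A.det * (y * c y)) :
    (c ∘ t) ⬝ᵥ A *ᵥ t ≠ β := by
  obtain ⟨y, hy⟩ := self_pairing_eq_neg_det_mul_norm c hc hA hdet hs hss t hst
  rw [hy]
  exact (hβ y).symm

/-- **the same along the whole `K·s`-coset**: `B(t + λ•s, t + λ•s) = B(t,t)` for `s` isotropic and `t ⊥ s` — the self-pairing on `s^⊥` factors through
`s^⊥ ∕ K·s`. [cite: Omeara1963, §42] -/
theorem self_pairing_add_smul_eq (hc : ∀ a, c (c a) = a) {n : Type*} [Fintype n] {A : Matrix n n K}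
    (hA : ∀ i j, c (A i j) = A j i) {s : n → K} (hss : (c ∘ s) ⬝ᵥ A *ᵥ s = 0) (t : n → K) (hst : (c ∘ s) ⬝ᵥ A *ᵥ t = 0) (lam : K) :
    (c ∘ (t + lam • s)) ⬝ᵥ A *ᵥ (t + lam • s) = (c ∘ t) ⬝ᵥ A *ᵥ t := by
  have hts : (c ∘ t) ⬝ᵥ A *ᵥ s = 0 := by rw [← map_conj_dotProduct_mulVec c hc hA, hst, map_zero]
  have h : (c ∘ (t + lam • s) : n → K) = (c ∘ t) + c lam • (c ∘ s) := funext fun i => by simp [map_add, map_mul]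
  rw [h, add_dotProduct, smul_dotProduct, conj_dotProduct_mulVec_add, conj_dotProduct_mulVec_add, conj_dotProduct_mulVec_smul,
    conj_dotProduct_mulVec_smul, hss, hst, hts]
  simp

end Witt

/-! ## §3 The local reading at a non-split finite place of a CM field: Hilbert-symbol class of `⟨t,t⟩` on the incidence variety -/

section CM

open NumberField IsDedekindDomain
open Literature.NumberTheory.Automorphic Literature.NumberTheory.Automorphic.UnitaryGroup Literature.NumberTheory.GaloisRepresentations
open Literature.NumberTheory.QuadraticForms Literature.NumberTheory.Rogawski1990

variable (L : Type) [Field L] [NumberField L] [IsCMField L] (v : HeightOneSpectrum (𝓞 ↥(maximalRealSubfield L)))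
  (w : PlacesOver L v) (hw : IsCMField.complexConj L • w.1 = w.1)

include hw in
/-- **THE NORM CLASS ON `Z°`, HILBERT-SYMBOL CURRENCY.**  `L` CM, `v` a finite place of `L⁺` with `w ∣ v` fixed by complex conjugation (non-split), `σ_w` the
local conjugation of `L_w`, `A ∈ M₃(L_w)` hermitian for `σ_w` with `det A = ι_w(a)`, `a ∈ L⁺_v` non-zero.  If `s ≠ 0` is isotropic, `t ⊥ s` and `⟨t,t⟩ = ι_w(b)` with
`b ≠ 0`, then **`(−b·a⁻¹, θ)_v = 1`** (`θ = cmQuadraticGenerator L`): `−b∕a` is a norm from `L_w` (§2 + ★ `hilbertSymbol_eq_one_iff_exists_norm_toPlace`).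
[cite: Omeara1963, §63B (63:10)] [cite: KudlaRallis1994, §2 (2.10)–(2.12)] -/
theorem hilbertSymbol_neg_self_pairing_div_det_eq_one {A : Matrix (Fin 3) (Fin 3) (w.1.adicCompletion L)}
    (hA : ∀ i j, galAdicCompletionMap (L := L) (IsCMField.complexConj L) hw (A i j) = A j i)
    {a b : v.adicCompletion ↥(maximalRealSubfield L)} (ha : a ≠ 0) (hb : b ≠ 0) (hdetA : A.det = toPlace v w a)
    {s : Fin 3 → w.1.adicCompletion L} (hs : s ≠ 0)
    (hss : (galAdicCompletionMap (L := L) (IsCMField.complexConj L) hw ∘ s) ⬝ᵥ A *ᵥ s = 0)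
    (t : Fin 3 → w.1.adicCompletion L) (hst : (galAdicCompletionMap (L := L) (IsCMField.complexConj L) hw ∘ s) ⬝ᵥ A *ᵥ t = 0)
    (hbt : (galAdicCompletionMap (L := L) (IsCMField.complexConj L) hw ∘ t) ⬝ᵥ A *ᵥ t = toPlace v w b) :
    hilbertSymbol (v.adicCompletion ↥(maximalRealSubfield L)) (-(b * a⁻¹))
      (algebraMap ↥(maximalRealSubfield L) _ (cmQuadraticGenerator L : ↥(maximalRealSubfield L))) = 1 := by
  haveI hquad : Algebra.IsQuadraticExtension ↥(maximalRealSubfield L) L := IsCMField.isQuadraticExtension L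
  have hσσ : ∀ x : w.1.adicCompletion L, galAdicCompletionMap (L := L) (IsCMField.complexConj L) hw
      (galAdicCompletionMap (L := L) (IsCMField.complexConj L) hw x) = x :=
    galAdicCompletionMap_galAdicCompletionMap_of_smul_eq (IsCMField.complexConj L) w (IsCMField.complexConj_ne_one L) hw
  have hta : toPlace v w a ≠ 0 := (map_ne_zero _).2 ha
  obtain ⟨y, hy⟩ := self_pairing_eq_neg_det_mul_norm (galAdicCompletionMap (L := L) (IsCMField.complexConj L) hw) hσσ hA
    (by rw [hdetA]; exact hta) hs hss t hst
  rw [hbt, hdetA] at hy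
  refine (hilbertSymbol_eq_one_iff_exists_norm_toPlace L v w hw (neg_ne_zero.2 (mul_ne_zero hb (inv_ne_zero ha)))).2 ⟨y, ?_⟩
  rw [map_neg, map_mul, map_inv₀, hy]
  field_simp

include hw in
/-- **THE SUPPORT LETTER OF THE BALL ROAD** (contrapositive): with `A`, `a` as above, a NON-ZERO parameter `β ∈ L⁺_v` of the DEAD class — `(−β·a⁻¹, θ)_v = −1`,
i.e. `−β∕a` not a norm from `L_w` — is never a value `⟨t,t⟩` (read through `ι_w`) at a point `(s,t)` of the incidence variety `{s ≠ 0, ⟨s,s⟩ = 0, ⟨s,t⟩ = 0}`.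
[cite: KudlaRallis1994, §2 (2.10)–(2.12)] [cite: Omeara1963, §63B] -/
theorem self_pairing_ne_toPlace_of_hilbertSymbol_eq_neg_one {A : Matrix (Fin 3) (Fin 3) (w.1.adicCompletion L)}
    (hA : ∀ i j, galAdicCompletionMap (L := L) (IsCMField.complexConj L) hw (A i j) = A j i)
    {a β : v.adicCompletion ↥(maximalRealSubfield L)} (ha : a ≠ 0) (hβ : β ≠ 0) (hdetA : A.det = toPlace v w a)
    (hclass : hilbertSymbol (v.adicCompletion ↥(maximalRealSubfield L)) (-(β * a⁻¹))
      (algebraMap ↥(maximalRealSubfield L) _ (cmQuadraticGenerator L : ↥(maximalRealSubfield L))) = -1)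
    {s : Fin 3 → w.1.adicCompletion L} (hs : s ≠ 0)
    (hss : (galAdicCompletionMap (L := L) (IsCMField.complexConj L) hw ∘ s) ⬝ᵥ A *ᵥ s = 0)
    (t : Fin 3 → w.1.adicCompletion L) (hst : (galAdicCompletionMap (L := L) (IsCMField.complexConj L) hw ∘ s) ⬝ᵥ A *ᵥ t = 0) :
    (galAdicCompletionMap (L := L) (IsCMField.complexConj L) hw ∘ t) ⬝ᵥ A *ᵥ t ≠ toPlace v w β := by
  intro h
  have h1 := hilbertSymbol_neg_self_pairing_div_det_eq_one L v w hw hA ha hβ hdetA hs hss t hst h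
  rw [h1] at hclass
  norm_num at hclass

end CM

end Summit.HodgeConjecture.HodgeConjecture.Cruxes.HLiu418.K2LiuIsotropicOrthogonalNormClass
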